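import Mathlib.LinearAlgebra.Matrix.Transvection
import Mathlib.LinearAlgebra.Matrix.SpecialLinearGroup
import Mathlib.Analysis.SpecialFunctions.SmoothTransition
import Mathlib.Analysis.Calculus.ContDiff.Operations
import Mathlib.Topology.Instances.Matrix
import HarnessLib

/-!
# Smooth paths from `1` to a matrix of determinant one

For the Cappell–Shaneson construction one needs, for `A ∈ SL(3, ℤ)`, a *smooth* path of invertible
real matrices from `1` to `A` which is constant near its end points: it trivialises the normal bundle
of the section circle of the mapping torus of `A` acting on `T³` (Cappell–Shaneson, *Some new
four-manifolds*, Ann. of Math. 104 (1976), §2; Gompf, *More Cappell–Shaneson spheres are standard*,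
Algebr. Geom. Topol. 10 (2010), §3: "straightening the corresponding linear diffeomorphism of `T³` to
the identity near `0`"). That `SL(n, ℝ)` is path connected is classical (it is generated by the
connected one-parameter groups of transvections; e.g. Hall, *Lie Groups, Lie Algebras, and
Representations* (2015), Prop. 1.10 / Cor. 3.45). We give the elementary proof: by Mathlib's pivot
decomposition (`Matrix.Pivot.diagonal_transvection_induction`) a matrix of determinant `1` is a
product of transvections and a diagonal matrix of determinant `1`, and (`n = 3`) the latter is itself
a product of transvections (`diag(a, a⁻¹) = w(a) w(-1)`, `w(a) = E₁₂(a) E₂₁(-a⁻¹) E₁₂(a)`); the path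
`θ ↦ E_{ij}(ρ(θ) c)` with Mathlib's `Real.smoothTransition` as `ρ` handles one transvection, and paths
multiply.

## Main definitions and results

* `Literature.SmoothMatrixPath M`: a smooth (entrywise `C^∞`) path `γ : ℝ → Mₙ(ℝ)` with a smooth
  two-sided inverse path, `γ θ = 1` for `θ ≤ 0` and `γ θ = M` for `1 ≤ θ`.
* `Literature.Topology.FourManifolds.SmoothMatrixPath.one`, `.mul`, `.transvection`: constant path, products, transvections.
* `Literature.Topology.FourManifolds.nonempty_smoothMatrixPath_of_det_eq_one`: every `M ∈ SL(3, ℝ)` has such a path;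
  `Literature.Topology.FourManifolds.nonempty_smoothMatrixPath_specialLinearGroup`: in particular every `A ∈ SL(3, ℤ)`.
* `Literature.Topology.FourManifolds.SmoothMatrixPath.exists_bound`: the entries of such a path are uniformly bounded.
-/

open scoped ContDiff
open Set Matrix

noncomputable section

namespace Literature.Topology.FourManifolds

variable {n : Type*} [Fintype n] [DecidableEq n]

/-- A **smooth path of invertible matrices from `1` to `M`, constant near the ends**: entrywise
`C^∞` maps `γ, γ⁻¹ : ℝ → Mₙ(ℝ)` with `γ θ * γ⁻¹ θ = 1 = γ⁻¹ θ * γ θ`, `γ θ = 1` for `θ ≤ 0` and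
`γ θ = M` for `θ ≥ 1` (the datum used to trivialise the normal bundle of the section circle of a
mapping torus; Cappell–Shaneson 1976, §2). [folklore] -/
structure SmoothMatrixPath (M : Matrix n n ℝ) where
  /-- The path. -/
  toFun : ℝ → Matrix n n ℝ
  /-- The pointwise inverse path. -/
  inv : ℝ → Matrix n n ℝ
  /-- The entries of the path are smooth. -/
  contDiff_apply : ∀ i j, ContDiff ℝ ∞ fun θ ↦ toFun θ i j
  /-- The entries of the inverse path are smooth. -/
  contDiff_inv_apply : ∀ i j, ContDiff ℝ ∞ fun θ ↦ inv θ i j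
  /-- `inv θ` is a right inverse of `toFun θ`. -/
  mul_inv : ∀ θ, toFun θ * inv θ = 1
  /-- `inv θ` is a left inverse of `toFun θ`. -/
  inv_mul : ∀ θ, inv θ * toFun θ = 1
  /-- The path starts (and stays for `θ ≤ 0`) at `1`. -/
  eq_one : ∀ θ ≤ (0 : ℝ), toFun θ = 1
  /-- The path ends (and stays for `θ ≥ 1`) at `M`. -/
  eq_self : ∀ θ, (1 : ℝ) ≤ θ → toFun θ = M

namespace SmoothMatrixPath

variable {M N : Matrix n n ℝ}

/-- The inverse path is `1` for `θ ≤ 0`. [folklore] -/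
theorem inv_eq_one (γ : SmoothMatrixPath M) {θ : ℝ} (hθ : θ ≤ 0) : γ.inv θ = 1 := by
  have := γ.inv_mul θ
  rwa [γ.eq_one θ hθ, Matrix.mul_one] at this

/-- The path and the inverse path, applied to vectors, are mutually inverse. [folklore] -/
theorem inv_mulVec_mulVec (γ : SmoothMatrixPath M) (θ : ℝ) (v : n → ℝ) :
    γ.inv θ *ᵥ (γ.toFun θ *ᵥ v) = v := by
  rw [mulVec_mulVec, γ.inv_mul, one_mulVec]

/-- The path and the inverse path, applied to vectors, are mutually inverse. [folklore] -/
theorem mulVec_inv_mulVec (γ : SmoothMatrixPath M) (θ : ℝ) (v : n → ℝ) :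
    γ.toFun θ *ᵥ (γ.inv θ *ᵥ v) = v := by
  rw [mulVec_mulVec, γ.mul_inv, one_mulVec]

/-- The path is continuous (as a matrix-valued map). [folklore] -/
theorem continuous (γ : SmoothMatrixPath M) : Continuous γ.toFun :=
  continuous_matrix fun i j ↦ (γ.contDiff_apply i j).continuous

/-- The constant path at `1`. [folklore] -/
def one : SmoothMatrixPath (1 : Matrix n n ℝ) where
  toFun _ := 1
  inv _ := 1
  contDiff_apply _ _ := contDiff_const
  contDiff_inv_apply _ _ := contDiff_const
  mul_inv _ := Matrix.mul_one _
  inv_mul _ := Matrix.mul_one _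
  eq_one _ _ := rfl
  eq_self _ _ := rfl

omit [DecidableEq n] in
/-- Entries of a product of entrywise smooth matrix paths are smooth. [folklore] -/
theorem contDiff_mul_apply {f g : ℝ → Matrix n n ℝ} (hf : ∀ i j, ContDiff ℝ ∞ fun θ ↦ f θ i j)
    (hg : ∀ i j, ContDiff ℝ ∞ fun θ ↦ g θ i j) (i j : n) :
    ContDiff ℝ ∞ fun θ ↦ (f θ * g θ) i j := by
  simp only [Matrix.mul_apply]
  exact ContDiff.sum fun k _ ↦ (hf i k).mul (hg k j)

/-- **Paths multiply**: the pointwise product of paths from `1` to `M` and to `N` is a path from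
`1` to `M * N`. [folklore] -/
def mul (γ : SmoothMatrixPath M) (δ : SmoothMatrixPath N) : SmoothMatrixPath (M * N) where
  toFun θ := γ.toFun θ * δ.toFun θ
  inv θ := δ.inv θ * γ.inv θ
  contDiff_apply := contDiff_mul_apply γ.contDiff_apply δ.contDiff_apply
  contDiff_inv_apply := contDiff_mul_apply δ.contDiff_inv_apply γ.contDiff_inv_apply
  mul_inv θ := by
    rw [Matrix.mul_assoc, ← Matrix.mul_assoc (δ.toFun θ), δ.mul_inv, Matrix.one_mul, γ.mul_inv]
  inv_mul θ := by
    rw [Matrix.mul_assoc, ← Matrix.mul_assoc (γ.inv θ), γ.inv_mul, Matrix.one_mul, δ.inv_mul]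
  eq_one θ hθ := by rw [γ.eq_one θ hθ, δ.eq_one θ hθ, Matrix.mul_one]
  eq_self θ hθ := by rw [γ.eq_self θ hθ, δ.eq_self θ hθ]

/-- Transport of a path along an equality of end points. [folklore] -/
def cast (γ : SmoothMatrixPath M) (h : M = N) : SmoothMatrixPath N where
  toFun := γ.toFun
  inv := γ.inv
  contDiff_apply := γ.contDiff_apply
  contDiff_inv_apply := γ.contDiff_inv_apply
  mul_inv := γ.mul_inv
  inv_mul := γ.inv_mul
  eq_one := γ.eq_one
  eq_self θ hθ := h ▸ γ.eq_self θ hθ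

omit [Fintype n] in
/-- The entries of `θ ↦ E_{ij}(ρ(θ) c)` are smooth, `ρ` Mathlib's smooth transition function. [folklore] -/
theorem contDiff_transvection_apply (i j : n) (c : ℝ) (p q : n) :
    ContDiff ℝ ∞ fun θ ↦ Matrix.transvection i j (Real.smoothTransition θ * c) p q := by
  simp only [Matrix.transvection, Matrix.add_apply, Matrix.single_apply]
  split_ifs
  · exact contDiff_const.add ((Real.smoothTransition.contDiff (n := ⊤)).mul contDiff_const)
  · exact contDiff_const.add contDiff_const

/-- **The path of a transvection**: `θ ↦ E_{ij}(ρ(θ) c)` runs smoothly from `1` (`θ ≤ 0`) to the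
transvection `E_{ij}(c)` (`θ ≥ 1`) through transvections, with inverse `E_{ij}(-ρ(θ) c)`. [folklore] -/
def transvection {i j : n} (hij : i ≠ j) (c : ℝ) :
    SmoothMatrixPath (Matrix.transvection i j c) where
  toFun θ := Matrix.transvection i j (Real.smoothTransition θ * c)
  inv θ := Matrix.transvection i j (-(Real.smoothTransition θ * c))
  contDiff_apply := contDiff_transvection_apply i j c
  contDiff_inv_apply p q := by
    have h := contDiff_transvection_apply i j (-c) p q
    simp only [mul_neg] at h
    exact h
  mul_inv θ := by
    rw [transvection_mul_transvection_same _ _ hij, add_neg_cancel, transvection_zero]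
  inv_mul θ := by
    rw [transvection_mul_transvection_same _ _ hij, neg_add_cancel, transvection_zero]
  eq_one θ hθ := by
    rw [Real.smoothTransition.zero_of_nonpos hθ, zero_mul, transvection_zero]
  eq_self θ hθ := by
    rw [Real.smoothTransition.one_of_one_le hθ, one_mul]

/-- The path of a `TransvectionStruct`. [folklore] -/
def ofTransvectionStruct (t : TransvectionStruct n ℝ) : SmoothMatrixPath t.toMatrix :=
  transvection t.hij t.c

end SmoothMatrixPath

/-! ### Diagonal matrices of determinant one in dimension `3` are products of transvections -/

section FinThree

/-- `E₀₁(a) E₁₀(-a⁻¹) E₀₁(a) = w(a)`, the monomial matrix `!![0, a, 0; -a⁻¹, 0, 0; 0, 0, 1]`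
(`a ≠ 0`). [folklore] -/
theorem transvection_mul_eq_w (a : ℝ) (ha : a ≠ 0) :
    Matrix.transvection (0 : Fin 3) 1 a * Matrix.transvection (1 : Fin 3) 0 (-a⁻¹) *
        Matrix.transvection (0 : Fin 3) 1 a =
      !![0, a, 0; -a⁻¹, 0, 0; 0, 0, 1] := by
  ext i j
  fin_cases i <;> fin_cases j <;>
    simp [Matrix.transvection, Matrix.mul_apply, Fin.sum_univ_three, Matrix.single_apply,
      Matrix.one_apply, ha]

/-- `diag(a, a⁻¹, 1) = w(a) w(-1)` is a product of six transvections (`a ≠ 0`). [folklore] -/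
theorem diagonal_eq_transvection_mul₀₁ (a : ℝ) (ha : a ≠ 0) :
    Matrix.diagonal ![a, a⁻¹, 1] =
      Matrix.transvection (0 : Fin 3) 1 a * Matrix.transvection (1 : Fin 3) 0 (-a⁻¹) *
        Matrix.transvection (0 : Fin 3) 1 a *
      (Matrix.transvection (0 : Fin 3) 1 (-1) * Matrix.transvection (1 : Fin 3) 0 (-(-1 : ℝ)⁻¹) *
        Matrix.transvection (0 : Fin 3) 1 (-1)) := by
  rw [transvection_mul_eq_w a ha, transvection_mul_eq_w (-1) (by norm_num)]
  ext i j
  fin_cases i <;> fin_cases j <;> simp [Matrix.mul_apply, Fin.sum_univ_three]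

/-- `E₁₂(b) E₂₁(-b⁻¹) E₁₂(b) = w'(b)`, the monomial matrix `!![1, 0, 0; 0, 0, b; 0, -b⁻¹, 0]`
(`b ≠ 0`). [folklore] -/
theorem transvection_mul_eq_w' (b : ℝ) (hb : b ≠ 0) :
    Matrix.transvection (1 : Fin 3) 2 b * Matrix.transvection (2 : Fin 3) 1 (-b⁻¹) *
        Matrix.transvection (1 : Fin 3) 2 b =
      !![1, 0, 0; 0, 0, b; 0, -b⁻¹, 0] := by
  ext i j
  fin_cases i <;> fin_cases j <;>
    simp [Matrix.transvection, Matrix.mul_apply, Fin.sum_univ_three, Matrix.single_apply,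
      Matrix.one_apply, hb]

/-- `diag(1, b, b⁻¹) = w'(b) w'(-1)` is a product of six transvections (`b ≠ 0`). [folklore] -/
theorem diagonal_eq_transvection_mul₁₂ (b : ℝ) (hb : b ≠ 0) :
    Matrix.diagonal ![1, b, b⁻¹] =
      Matrix.transvection (1 : Fin 3) 2 b * Matrix.transvection (2 : Fin 3) 1 (-b⁻¹) *
        Matrix.transvection (1 : Fin 3) 2 b *
      (Matrix.transvection (1 : Fin 3) 2 (-1) * Matrix.transvection (2 : Fin 3) 1 (-(-1 : ℝ)⁻¹) *
        Matrix.transvection (1 : Fin 3) 2 (-1)) := by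
  rw [transvection_mul_eq_w' b hb, transvection_mul_eq_w' (-1) (by norm_num)]
  ext i j
  fin_cases i <;> fin_cases j <;> simp [Matrix.mul_apply, Fin.sum_univ_three]

/-- A diagonal `3 × 3` matrix of determinant `1` factors as `diag(a, a⁻¹, 1) · diag(1, b, b⁻¹)` with
`a = d₀`, `b = d₀ d₁`. [folklore] -/
theorem diagonal_eq_of_det_eq_one (d : Fin 3 → ℝ) (hd : d 0 * d 1 * d 2 = 1) :
    Matrix.diagonal d =
      Matrix.diagonal ![d 0, (d 0)⁻¹, 1] * Matrix.diagonal ![1, d 0 * d 1, (d 0 * d 1)⁻¹] := by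
  have h0 : d 0 ≠ 0 := by
    intro h; rw [h] at hd; simp at hd
  have h1 : d 1 ≠ 0 := by
    intro h; rw [h] at hd; simp at hd
  have h2 : d 2 = (d 0 * d 1)⁻¹ := (inv_eq_of_mul_eq_one_right hd).symm
  rw [Matrix.diagonal_mul_diagonal]
  congr 1
  funext i
  fin_cases i
  · simp
  · simp [h0]
  · simp [h2]

/-- **A diagonal `3 × 3` real matrix of determinant `1` has a smooth path from `1` through
invertible matrices** (it is a product of twelve transvections). [folklore] -/
def SmoothMatrixPath.diagonal (d : Fin 3 → ℝ) (hd : d 0 * d 1 * d 2 = 1) :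
    SmoothMatrixPath (Matrix.diagonal d) := by
  have h0 : d 0 ≠ 0 := by
    intro h; rw [h] at hd; simp at hd
  have h1 : d 1 ≠ 0 := by
    intro h; rw [h] at hd; simp at hd
  have h01 : (0 : Fin 3) ≠ 1 := by decide
  have h10 : (1 : Fin 3) ≠ 0 := by decide
  have h12 : (1 : Fin 3) ≠ 2 := by decide
  have h21 : (2 : Fin 3) ≠ 1 := by decide
  refine SmoothMatrixPath.cast (SmoothMatrixPath.mul ?_ ?_) (diagonal_eq_of_det_eq_one d hd).symm
  · refine SmoothMatrixPath.cast ?_ (diagonal_eq_transvection_mul₀₁ (d 0) h0).symm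
    exact ((SmoothMatrixPath.transvection h01 _).mul (.transvection h10 _) |>.mul
      (.transvection h01 _)).mul
      (((SmoothMatrixPath.transvection h01 _).mul (.transvection h10 _)).mul (.transvection h01 _))
  · refine SmoothMatrixPath.cast ?_ (diagonal_eq_transvection_mul₁₂ (d 0 * d 1) (mul_ne_zero h0 h1)).symm
    exact ((SmoothMatrixPath.transvection h12 _).mul (.transvection h21 _) |>.mul
      (.transvection h12 _)).mul
      (((SmoothMatrixPath.transvection h12 _).mul (.transvection h21 _)).mul (.transvection h12 _))

/-- **Smooth paths in `SL(3, ℝ)`.** Every real `3 × 3` matrix of determinant `1` is the end point of a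
smooth path of invertible matrices starting at `1` and constant near both ends (`SL(3, ℝ)` is
generated by transvections; Cappell–Shaneson 1976, §2 use the resulting framing of the section
circle). [folklore] -/
theorem nonempty_smoothMatrixPath_of_det_eq_one (M : Matrix (Fin 3) (Fin 3) ℝ) (hM : M.det = 1) :
    Nonempty (SmoothMatrixPath M) := by
  refine Matrix.diagonal_transvection_induction (fun N ↦ Nonempty (SmoothMatrixPath N)) M ?_ ?_ ?_
  · intro D hD
    rw [hM, Matrix.det_diagonal, Fin.prod_univ_three] at hD
    exact ⟨SmoothMatrixPath.diagonal D hD⟩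
  · exact fun t ↦ ⟨SmoothMatrixPath.ofTransvectionStruct t⟩
  · rintro A B ⟨γ⟩ ⟨δ⟩
    exact ⟨γ.mul δ⟩

/-- The real matrix underlying an element of `SL(3, ℤ)`; definitionally the matrix of the image of
`A` under Mathlib's `Matrix.SpecialLinearGroup.map (Int.castRingHom ℝ) : SL(3, ℤ) →* SL(3, ℝ)`
(`slRealMatrix_eq_coe_map`). [folklore] -/
def slRealMatrix (A : Matrix.SpecialLinearGroup (Fin 3) ℤ) : Matrix (Fin 3) (Fin 3) ℝ :=
  (A : Matrix (Fin 3) (Fin 3) ℤ).map (Int.cast : ℤ → ℝ)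

/-- `slRealMatrix A` is the matrix of `Matrix.SpecialLinearGroup.map (Int.castRingHom ℝ) A`. [folklore] -/
theorem slRealMatrix_eq_coe_map (A : Matrix.SpecialLinearGroup (Fin 3) ℤ) :
    slRealMatrix A = ((Matrix.SpecialLinearGroup.map (Int.castRingHom ℝ) A :
      Matrix.SpecialLinearGroup (Fin 3) ℝ) : Matrix (Fin 3) (Fin 3) ℝ) := rfl

/-- Entries of `slRealMatrix A` are the casts of the entries of `A`. [folklore] -/
@[simp] theorem slRealMatrix_apply (A : Matrix.SpecialLinearGroup (Fin 3) ℤ) (i j : Fin 3) :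
    slRealMatrix A i j = ((A : Matrix (Fin 3) (Fin 3) ℤ) i j : ℝ) := rfl

/-- `slRealMatrix A` has determinant `1`. [folklore] -/
theorem det_slRealMatrix (A : Matrix.SpecialLinearGroup (Fin 3) ℤ) : (slRealMatrix A).det = 1 := by
  have h := RingHom.map_det (Int.castRingHom ℝ) (A : Matrix (Fin 3) (Fin 3) ℤ)
  rw [A.2, map_one] at h
  rw [slRealMatrix]
  exact h.symm

/-- **Every `A ∈ SL(3, ℤ)` has a smooth path of invertible real matrices from `1` to `A`, constant
near the ends** (the framing of the section circle in the Cappell–Shaneson construction;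
Cappell–Shaneson 1976, §2; Gompf 2010, §3). [folklore] -/
theorem nonempty_smoothMatrixPath_specialLinearGroup (A : Matrix.SpecialLinearGroup (Fin 3) ℤ) :
    Nonempty (SmoothMatrixPath (slRealMatrix A)) :=
  nonempty_smoothMatrixPath_of_det_eq_one _ (det_slRealMatrix A)

end FinThree

/-! ### Uniform bounds -/

namespace SmoothMatrixPath

variable {M : Matrix n n ℝ}

/-- Each entry of a smooth matrix path is bounded on `ℝ` (it is continuous on `[0, 1]` and constant
outside). [folklore] -/
theorem exists_bound_apply (γ : SmoothMatrixPath M) (i j : n) :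
    ∃ K, 0 ≤ K ∧ ∀ θ, |γ.toFun θ i j| ≤ K := by
  obtain ⟨C, hC⟩ := isCompact_Icc.exists_bound_of_continuousOn
    ((γ.contDiff_apply i j).continuous.continuousOn (s := Icc (0 : ℝ) 1))
  refine ⟨max C (max 1 |M i j|), le_max_of_le_right (le_max_of_le_left zero_le_one), fun θ ↦ ?_⟩
  rcases le_or_gt θ 0 with h0 | h0
  · rw [γ.eq_one θ h0, Matrix.one_apply]
    refine le_max_of_le_right (le_max_of_le_left ?_)
    split_ifs <;> simp
  rcases le_or_gt 1 θ with h1 | h1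
  · rw [γ.eq_self θ h1]
    exact le_max_of_le_right (le_max_right _ _)
  · exact le_max_of_le_left (by simpa using hC θ ⟨h0.le, h1.le⟩)

/-- **The entries of a smooth matrix path are uniformly bounded.** [folklore] -/
theorem exists_bound (γ : SmoothMatrixPath M) : ∃ K, 0 ≤ K ∧ ∀ θ i j, |γ.toFun θ i j| ≤ K := by
  choose K hK0 hK using γ.exists_bound_apply
  refine ⟨∑ i, ∑ j, K i j, Finset.sum_nonneg fun i _ ↦ Finset.sum_nonneg fun j _ ↦ hK0 i j,
    fun θ i j ↦ (hK i j θ).trans ?_⟩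
  calc K i j ≤ ∑ j', K i j' :=
        Finset.single_le_sum (f := fun j' ↦ K i j') (fun j' _ ↦ hK0 i j') (Finset.mem_univ j)
    _ ≤ ∑ i', ∑ j', K i' j' :=
        Finset.single_le_sum (f := fun i' ↦ ∑ j', K i' j') (fun i' _ ↦
          Finset.sum_nonneg fun j' _ ↦ hK0 i' j') (Finset.mem_univ i)

end SmoothMatrixPath

end Literature.Topology.FourManifolds
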